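import Summits.ValiantsHypothesis.ValiantsHypothesis.Theorems.LacunarySymmetroidMatrixDescartesCensusLaguerreRows

/-!
# `DoorA26` census — Laguerre's partial-sum rules, CLOSED forms (the test abscissa as a sample point) + list lemmas

HONEST FRAMING.  Object-search cell `pub-symmetroid`, seat `val-sym-door-p1` (gen 12); helper file `--supports`
stmt-ValiantsHypothesis-19979 (`DoorA26 := PosRootLawAt 2 6 19`, OPEN, typed, never asserted).  Theorems about real polynomials
and lists; nothing here bounds `ζ_sym(2,6)`; registers unchanged; nothing bears on `MatrixDescartes` (stmt-ValiantsHypothesis-18050)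
or on `VP ≠ VNP`.

CONTENT.  §1 list lemmas for `WindowDescartes.sgnChanges`: sublist monotonicity (in the strengthened form
`sgnChanges l + [s·firstNZ l < 0]`), junction additivity at a shared non-zero value, the full count of an alternating list.
§2 the CLOSED forms of Laguerre's rules of `…CensusLaguerreRows`: the abscissa `a` itself may be the last (below) / first (above)
sample point — `laguerre_sgnChanges_below_closed`, `laguerre_sgnChanges_above_closed` (same smoothing `Q_M`, plus
`Q_M(a) = ∑_{m ≤ N} S_m + (M − N)·S_N`, of the sign of `f(a)` for `M` large).  Used by `…CensusLaguerreTwenty`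
(`laguerre_rows_of_twenty`: a hypothetical twenty has `20 ≤ V(bottom partial sums at t) + V(top partial sums at t)` at every `t`).
[cite: Laguerre1883, the partial-sum rules]; axioms standard; no definitions.
-/

set_option linter.dupNamespace false
set_option autoImplicit false

namespace Summit.ValiantsHypothesis.ValiantsHypothesis.Theorems.LacunarySymmetroidMatrixDescartes.Census

open Polynomial
open Summit.ValiantsHypothesis.ValiantsHypothesis.Theorems.KPlusLogSqLaw.WindowDescartes

section LaguerreClosed

/-! ### §1 List lemmas -/

/-- strengthened sublist monotonicity: `sgnChanges l + [s · firstNZ l < 0]` is monotone along sublists, for every `s`. [folklore] -/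
theorem sgnChanges_add_le_of_sublist {l₁ l₂ : List ℝ} (h : l₁.Sublist l₂) (s : ℝ) :
    sgnChanges l₁ + (if s * firstNZ l₁ < 0 then 1 else 0) ≤ sgnChanges l₂ + (if s * firstNZ l₂ < 0 then 1 else 0) := by
  induction h generalizing s with
  | slnil => simp
  | @cons l₁ l₂ y _ ih =>
    rw [sgnChanges_cons, firstNZ_cons]
    by_cases hy : y = 0
    · subst hy
      simp only [if_true, zero_mul, lt_self_iff_false, if_false, add_zero]
      exact ih s
    · rw [if_neg hy]
      have hih := ih s
      -- `[s F₂ < 0] ≤ [y F₂ < 0] + [s y < 0]`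
      have key : (if s * firstNZ l₂ < 0 then 1 else 0)
          ≤ (if y * firstNZ l₂ < 0 then 1 else 0) + (if s * y < 0 then 1 else 0) := by
        by_cases h1 : s * firstNZ l₂ < 0
        · have hF : firstNZ l₂ ≠ 0 := by
            intro h0; rw [h0, mul_zero] at h1; exact lt_irrefl _ h1
          by_cases h2 : y * firstNZ l₂ < 0
          · rw [if_pos h1, if_pos h2]; omega
          · have hyF : 0 < y * firstNZ l₂ := lt_of_le_of_ne (not_lt.mp h2) (mul_ne_zero hy hF).symm
            have h3 : s * y < 0 := by
              by_contra h3
              have h3' : 0 ≤ s * y := not_lt.mp h3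
              have hprod : 0 ≤ (s * y) * (y * firstNZ l₂) := mul_nonneg h3' hyF.le
              have e : (s * y) * (y * firstNZ l₂) = (s * firstNZ l₂) * (y * y) := by ring
              rw [e] at hprod
              exact absurd (mul_neg_of_neg_of_pos h1 (mul_self_pos.mpr hy)) (not_lt.mpr hprod)
            rw [if_pos h1, if_neg h2, if_pos h3]
        · rw [if_neg h1]; exact Nat.zero_le _
      calc sgnChanges l₁ + (if s * firstNZ l₁ < 0 then 1 else 0)
          ≤ sgnChanges l₂ + (if s * firstNZ l₂ < 0 then 1 else 0) := hih
        _ ≤ sgnChanges l₂ + ((if y * firstNZ l₂ < 0 then 1 else 0) + (if s * y < 0 then 1 else 0)) :=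
            Nat.add_le_add_left key _
        _ = sgnChanges l₂ + (if y * firstNZ l₂ < 0 then 1 else 0) + (if s * y < 0 then 1 else 0) := (add_assoc _ _ _).symm
  | @cons_cons l₁ l₂ y _ ih =>
    rw [sgnChanges_cons, sgnChanges_cons, firstNZ_cons, firstNZ_cons]
    by_cases hy : y = 0
    · subst hy
      simp only [if_true, zero_mul, lt_self_iff_false, if_false, add_zero]
      exact ih s
    · rw [if_neg hy, if_neg hy]
      exact Nat.add_le_add_right (ih y) _

/-- sublist monotonicity of `sgnChanges`. [folklore] -/
theorem sgnChanges_le_of_sublist {l₁ l₂ : List ℝ} (h : l₁.Sublist l₂) : sgnChanges l₁ ≤ sgnChanges l₂ := by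
  have := sgnChanges_add_le_of_sublist h 0
  simpa using this

/-- junction additivity at a shared non-zero value. [folklore] -/
theorem sgnChanges_append_junction (l₁ l₂ : List ℝ) {x : ℝ} (hx : x ≠ 0) :
    sgnChanges (l₁ ++ [x]) + sgnChanges (x :: l₂) = sgnChanges (l₁ ++ x :: l₂) := by
  induction l₁ with
  | nil => simp [sgnChanges_cons]
  | cons y l₁ ih =>
    have hF : firstNZ (l₁ ++ [x]) = firstNZ (l₁ ++ x :: l₂) := by
      simp [firstNZ_append, firstNZ_cons, hx]
    rw [List.cons_append, List.cons_append, sgnChanges_cons y (l₁ ++ [x]), sgnChanges_cons y (l₁ ++ x :: l₂), ← ih, hF,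
      Nat.add_right_comm]

/-- values alternating in sign along `slist`: the count is full. [folklore] -/
theorem sgnChanges_slist_of_alternating (g : ℕ → ℝ) (n : ℕ)
    (halt : ∀ i, i < n → g i * g (i + 1) < 0) : sgnChanges (slist g n) = n := by
  induction n with
  | zero => simp [sgnChanges_cons]
  | succ n ih =>
    have hn : g n ≠ 0 := fun h0 => by
      have := halt n (Nat.lt_succ_self n); rw [h0, zero_mul] at this; exact lt_irrefl _ this
    rw [slist_succ, sgnChanges_cons_of_neg, ih (fun i hi => halt i (Nat.lt_succ_of_lt hi))]
    rw [firstNZ_slist_of_ne_zero hn, mul_comm]; exact halt n (Nat.lt_succ_self n)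

/-- values alternating in sign along a map of `List.range`: the count is full. [folklore] -/
theorem sgnChanges_map_range_of_alternating (g : ℕ → ℝ) (n : ℕ)
    (halt : ∀ i, i < n → g i * g (i + 1) < 0) :
    sgnChanges ((List.range (n + 1)).map g) = n := by
  have hrev : (List.range (n + 1)).map g = (slist g n).reverse := by
    simp [slist, List.map_reverse]
  rw [hrev, sgnChanges_reverse]
  exact sgnChanges_slist_of_alternating g n halt

/-! ### §2 Closed forms of Laguerre's rules -/

/-- **Laguerre below, closed form**: the test abscissa `a` itself may be appended as the last sample point. [cite: Laguerre1883, the partial-sum rules] -/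
theorem laguerre_sgnChanges_below_closed (f : ℝ[X]) {N : ℕ} (hN : f.natDegree ≤ N) {a : ℝ} (ha : 0 < a)
    (xs : List ℝ) (hsort : xs.Pairwise (· < ·)) (hx0 : ∀ x ∈ xs, 0 < x) (hxa : ∀ x ∈ xs, x < a)
    (hne : ∀ x ∈ xs, f.eval x ≠ 0) (hfa : f.eval a ≠ 0) :
    sgnChanges ((xs ++ [a]).map fun x => f.eval x)
      ≤ sgnChanges (slist (fun m => ∑ k ∈ Finset.range (m + 1), f.coeff k * a ^ k) N) := by
  have ha0 : a ≠ 0 := ha.ne'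
  set S : ℕ → ℝ := fun m => ∑ k ∈ Finset.range (m + 1), f.coeff k * a ^ k with hS
  -- names kept parallel to `laguerre_sgnChanges_below`
  set xs' := xs with hxs'
  have hsort' : xs'.Pairwise (· < ·) := hsort
  have hx0' : ∀ x ∈ xs', 0 < x := hx0
  have hxa' : ∀ x ∈ xs', x < a := hxa
  have hne' : ∀ x ∈ xs', f.eval x ≠ 0 := hne
  have hSN : S N = f.eval a := by
    rw [hS, Polynomial.eval_eq_sum_range' (Nat.lt_succ_of_le hN) a]
  -- Step 2: the truncated smoothing `Q M`
  let γ : ℕ → ℕ → ℝ := fun M m => S (min m N) * (a⁻¹) ^ m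
  let Q : ℕ → ℝ[X] := fun M => ∑ m ∈ Finset.range (M + 1), Polynomial.monomial m (γ M m)
  have hQcoeff : ∀ M m, (Q M).coeff m = if m < M + 1 then γ M m else 0 := by
    intro M m
    simp only [Q, Polynomial.finsetSum_coeff, Polynomial.coeff_monomial, Finset.sum_ite_eq', Finset.mem_range]
  have hQdeg : ∀ M, (Q M).natDegree ≤ M := by
    intro M
    rw [Polynomial.natDegree_le_iff_coeff_eq_zero]
    intro i hi
    rw [hQcoeff, if_neg (by exact_mod_cast (show ¬ (i < M + 1) by exact_mod_cast (by omega)))]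
  have hQeval : ∀ M x, (Q M).eval x = ∑ m ∈ Finset.range (M + 1), S (min m N) * (x / a) ^ m := by
    intro M x
    simp only [Q, Polynomial.eval_finsetSum, Polynomial.eval_monomial, γ]
    refine Finset.sum_congr rfl fun m _ => ?_
    rw [div_eq_mul_inv, mul_pow, mul_assoc, mul_comm (x ^ m)]
  -- value at `a`: `Q M (a) = ∑_{m ≤ N} S m + (M - N) · S N`
  have hQa : ∀ M, N ≤ M → (Q M).eval a = (∑ m ∈ Finset.range (N + 1), S m) + ((M - N : ℕ) : ℝ) * S N := by
    intro M hM
    rw [hQeval]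
    have h1 : ∀ m ∈ Finset.range (M + 1), S (min m N) * (a / a) ^ m = S (min m N) := fun m _ => by
      rw [div_self ha0, one_pow, mul_one]
    rw [Finset.sum_congr rfl h1, Finset.range_eq_Ico,
      ← Finset.sum_Ico_consecutive _ (Nat.zero_le (N + 1)) (by omega : N + 1 ≤ M + 1), ← Finset.range_eq_Ico]
    have hA : ∑ m ∈ Finset.range (N + 1), S (min m N) = ∑ m ∈ Finset.range (N + 1), S m :=
      Finset.sum_congr rfl fun m hm => by rw [Finset.mem_range] at hm; rw [Nat.min_eq_left (by omega)]
    have hB : ∑ m ∈ Finset.Ico (N + 1) (M + 1), S (min m N) = ((M - N : ℕ) : ℝ) * S N := by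
      calc ∑ m ∈ Finset.Ico (N + 1) (M + 1), S (min m N) = ∑ m ∈ Finset.Ico (N + 1) (M + 1), S N :=
            Finset.sum_congr rfl fun m hm => by
              rw [Finset.mem_Ico] at hm
              show S (min m N) = S N
              rw [Nat.min_eq_right (by omega : N ≤ m)]
        _ = ((M - N : ℕ) : ℝ) * S N := by
            rw [Finset.sum_const, Nat.card_Ico, nsmul_eq_mul]
            congr 2; omega
    rw [hA, hB]
  -- Step 3: choose `M`: error small at every `x ∈ xs'`, and `(M - N)|S N| > |∑ S m|`
  have hM : ∃ M₀ : ℕ, ∀ M, M₀ ≤ M → ∀ x ∈ xs', |S N * (x / a) ^ (M + 1)| < |f.eval x| := by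
    refine exists_forall_ge_of_forall_mem xs' fun x hx => ?_
    have hq0 : 0 ≤ x / a := div_nonneg (hx0' x hx).le ha.le
    have hq1 : x / a < 1 := (div_lt_one ha).mpr (hxa' x hx)
    have hfx : 0 < |f.eval x| := abs_pos.mpr (hne' x hx)
    have hS0 : 0 < |S N| := abs_pos.mpr (by rw [hSN]; exact hfa)
    obtain ⟨n, hn⟩ := exists_pow_lt_of_lt_one (div_pos hfx hS0) hq1
    refine ⟨n, fun M hM => ?_⟩
    rw [abs_mul, abs_pow, abs_of_nonneg hq0]
    calc |S N| * (x / a) ^ (M + 1) ≤ |S N| * (x / a) ^ n :=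
          mul_le_mul_of_nonneg_left (pow_le_pow_of_le_one hq0 hq1.le (by omega)) hS0.le
      _ < |S N| * (|f.eval x| / |S N|) := mul_lt_mul_of_pos_left hn hS0
      _ = |f.eval x| := mul_div_cancel₀ _ hS0.ne'
  obtain ⟨M₀, hM₀⟩ := hM
  obtain ⟨K, hK⟩ : ∃ K : ℕ, |∑ m ∈ Finset.range (N + 1), S m| / |S N| < K := exists_nat_gt _
  set M := max M₀ (N + K + 1) with hMdef
  have hMN : N ≤ M := le_trans (by omega : N ≤ N + K + 1) (le_max_right _ _)
  have herr := hM₀ M (le_max_left _ _)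
  -- Step 4: signs at the sample points and at `a`
  have hsign : ∀ x ∈ xs', SignType.sign (f.eval x) = SignType.sign ((Q M).eval x) := by
    intro x hx
    have h1x : 0 < 1 - x / a := by have := (div_lt_one ha).mpr (hxa' x hx); linarith
    have hid := laguerre_identity f hN ha0 hMN x
    rw [← hQeval] at hid
    have hQ : SignType.sign ((Q M).eval x) = SignType.sign (f.eval x + (-(S N * (x / a) ^ (M + 1)))) := by
      rw [← sub_eq_add_neg, ← hid, sign_mul, sign_pos h1x, one_mul]
    rw [hQ, sign_add_eq_sign_of_abs_lt (by rw [abs_neg]; exact herr x hx)]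
  have hsigna : SignType.sign (f.eval a) = SignType.sign ((Q M).eval a) := by
    have hS0 : 0 < |S N| := abs_pos.mpr (by rw [hSN]; exact hfa)
    have hKM : (K : ℝ) ≤ ((M - N : ℕ) : ℝ) := by
      have hMK : K ≤ M - N := by omega
      exact_mod_cast hMK
    have hMNpos : (0 : ℝ) < ((M - N : ℕ) : ℝ) := by
      have h0 : 0 < M - N := by omega
      exact_mod_cast h0
    have hlt : |∑ m ∈ Finset.range (N + 1), S m| < |((M - N : ℕ) : ℝ) * S N| := by
      rw [abs_mul, abs_of_pos hMNpos]
      calc |∑ m ∈ Finset.range (N + 1), S m|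
          = |∑ m ∈ Finset.range (N + 1), S m| / |S N| * |S N| := by rw [div_mul_cancel₀ _ hS0.ne']
        _ < K * |S N| := mul_lt_mul_of_pos_right hK hS0
        _ ≤ ((M - N : ℕ) : ℝ) * |S N| := mul_le_mul_of_nonneg_right hKM hS0.le
    rw [hQa M hMN, add_comm, sign_add_eq_sign_of_abs_lt hlt, sign_mul, sign_pos hMNpos, one_mul, hSN]
  have hsign' : ∀ x ∈ xs' ++ [a], SignType.sign (f.eval x) = SignType.sign ((Q M).eval x) := by
    intro x hx
    rcases List.mem_append.mp hx with hx | hx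
    · exact hsign x hx
    · rw [List.mem_singleton] at hx; subst hx; exact hsigna
  have hQne : ∀ x ∈ xs' ++ [a], (Q M).eval x ≠ 0 := by
    intro x hx h0
    have := hsign' x hx
    rw [h0, sign_zero, sign_eq_zero_iff] at this
    rcases List.mem_append.mp hx with hx' | hx'
    · exact hne' x hx' this
    · rw [List.mem_singleton] at hx'; subst hx'; exact hfa this
  have hsortA : (xs' ++ [a]).Pairwise (· < ·) := by
    rw [List.pairwise_append]
    exact ⟨hsort', List.pairwise_singleton _ _, fun x hx y hy => by rw [List.mem_singleton] at hy; subst hy; exact hxa' x hx⟩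
  have hposA : ∀ x ∈ xs' ++ [a], 0 < x := by
    intro x hx
    rcases List.mem_append.mp hx with hx | hx
    · exact hx0' x hx
    · rw [List.mem_singleton] at hx; subst hx; exact ha
  -- Step 5: Descartes along the points for `Q M`, and its coefficient sign pattern
  calc sgnChanges ((xs' ++ [a]).map fun x => f.eval x)
      = sgnChanges ((xs' ++ [a]).map fun x => (Q M).eval x) := sgnChanges_congr (forall₂_map_of_forall hsign')
    _ ≤ (Q M).signVariations := sgnChanges_eval_le_signVariations (Q M) _ hsortA hposA hQne
    _ = sgnChanges (slist (fun m => (Q M).coeff m) M) := signVariations_eq_sgnChanges_slist (Q M) (hQdeg M)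
    _ = sgnChanges (slist (fun m => S (min m N)) M) := by
        refine sgnChanges_slist_congr_sign fun m hm => ?_
        rw [hQcoeff, if_pos (by omega)]
        show SignType.sign (S (min m N) * (a⁻¹) ^ m) = SignType.sign (S (min m N))
        rw [sign_mul, sign_pos (pow_pos (inv_pos.mpr ha) m), mul_one]
    _ = sgnChanges (slist (fun m => S (min m N)) N) := by
        obtain ⟨e, he⟩ : ∃ e, M = N + e := ⟨M - N, by omega⟩
        rw [he]
        have h0 : S N ≠ 0 := by rw [hSN]; exact hfa
        have hNN : (fun m => S (min m N)) N ≠ 0 := by simpa using h0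
        refine sgnChanges_slist_add_of_sameSign_top _ N e hNN fun i hi _ => ?_
        show 0 < S (min i N) * S (min N N)
        rw [Nat.min_eq_right hi.le, Nat.min_self]
        exact mul_self_pos.mpr h0
    _ = sgnChanges (slist S N) := congrArg sgnChanges (slist_congr fun m hm => by
        show S (min m N) = S m; rw [Nat.min_eq_left hm])

/-- **Laguerre above, closed form**: the test abscissa `a` itself may be prepended as the first sample point. [cite: Laguerre1883, the partial-sum rules] -/
theorem laguerre_sgnChanges_above_closed (f : ℝ[X]) {N : ℕ} (hN : f.natDegree ≤ N) {a : ℝ} (ha : 0 < a)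
    (xs : List ℝ) (hsort : xs.Pairwise (· < ·)) (hxa : ∀ x ∈ xs, a < x)
    (hne : ∀ x ∈ xs, f.eval x ≠ 0) (hfa : f.eval a ≠ 0) :
    sgnChanges ((a :: xs).map fun x => f.eval x)
      ≤ sgnChanges (slist (fun m => ∑ k ∈ Finset.Ico m (N + 1), f.coeff k * a ^ k) N) := by
  have ha0 : a ≠ 0 := ha.ne'
  have hx0 : ∀ x ∈ xs, 0 < x := fun x hx => ha.trans (hxa x hx)
  -- the reflected polynomial `g(u) = ∑_j coeff f (N - j) · a^(N-j) · u^j`, as in `laguerre_sgnChanges_above`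
  let δ : ℕ → ℝ := fun j => f.coeff (N - j) * a ^ (N - j)
  let g : ℝ[X] := ∑ j ∈ Finset.range (N + 1), Polynomial.monomial j (δ j)
  have hgcoeff : ∀ j, g.coeff j = if j < N + 1 then δ j else 0 := by
    intro j
    simp only [g, Polynomial.finsetSum_coeff, Polynomial.coeff_monomial, Finset.sum_ite_eq', Finset.mem_range]
  have hgdeg : g.natDegree ≤ N := by
    rw [Polynomial.natDegree_le_iff_coeff_eq_zero]
    intro i hi
    rw [hgcoeff, if_neg (by exact_mod_cast (show ¬ (i < N + 1) by exact_mod_cast (by omega)))]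
  have hgeval : ∀ x, x ≠ 0 → g.eval (a / x) = (a / x) ^ N * f.eval x := by
    intro x hx
    simp only [g, Polynomial.eval_finsetSum, Polynomial.eval_monomial, δ]
    rw [Polynomial.eval_eq_sum_range' (Nat.lt_succ_of_le hN) x, Finset.mul_sum,
      ← Finset.sum_range_reflect (fun k => (a / x) ^ N * (f.coeff k * x ^ k)) (N + 1)]
    refine Finset.sum_congr rfl fun j hj => ?_
    rw [Finset.mem_range] at hj
    rw [show N + 1 - 1 - j = N - j by omega]
    have hsplit : (a / x) ^ N = (a / x) ^ (N - j) * (a / x) ^ j := by rw [← pow_add]; congr 1; omega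
    rw [hsplit, div_pow a x (N - j)]
    field_simp
  set us := (xs.map fun x => a / x).reverse with hus
  have husort : us.Pairwise (· < ·) := by
    rw [hus, List.pairwise_reverse, List.pairwise_map]
    exact hsort.imp_of_mem fun {x y} hx hy hxy => div_lt_div_of_pos_left ha (hx0 x hx) hxy
  have hu0 : ∀ u ∈ us, 0 < u := by
    intro u hu
    rw [hus, List.mem_reverse, List.mem_map] at hu
    obtain ⟨x, hx, rfl⟩ := hu
    exact div_pos ha (hx0 x hx)
  have hu1 : ∀ u ∈ us, u < 1 := by
    intro u hu
    rw [hus, List.mem_reverse, List.mem_map] at hu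
    obtain ⟨x, hx, rfl⟩ := hu
    exact (div_lt_one (hx0 x hx)).mpr (hxa x hx)
  have hvals : sgnChanges ((a :: xs).map fun x => f.eval x) = sgnChanges ((us ++ [1]).map fun u => g.eval u) := by
    have e1 : (us ++ [1]) = ((a :: xs).map fun x => a / x).reverse := by
      rw [List.map_cons, List.reverse_cons, div_self ha0, hus]
    rw [e1, List.map_reverse, sgnChanges_reverse, List.map_map]
    refine sgnChanges_congr (forall₂_map_of_forall fun x hx => ?_)
    have hxpos : 0 < x := by
      rcases List.mem_cons.mp hx with rfl | hx
      · exact ha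
      · exact hx0 x hx
    show SignType.sign (f.eval x) = SignType.sign (g.eval (a / x))
    rw [hgeval x hxpos.ne', sign_mul, sign_pos (pow_pos (div_pos ha hxpos) N), one_mul]
  rw [hvals]
  have hune : ∀ u ∈ us, g.eval u ≠ 0 := by
    intro u hu
    rw [hus, List.mem_reverse, List.mem_map] at hu
    obtain ⟨x, hx, rfl⟩ := hu
    rw [hgeval x (hx0 x hx).ne']
    exact mul_ne_zero (pow_ne_zero _ (div_pos ha (hx0 x hx)).ne') (hne x hx)
  have hg1 : g.eval 1 ≠ 0 := by
    have := hgeval a ha0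
    rw [div_self ha0] at this
    rw [this, one_pow, one_mul]; exact hfa
  have hbelow := laguerre_sgnChanges_below_closed g hgdeg one_pos us husort hu0 hu1 hune hg1
  refine hbelow.trans (le_of_eq ?_)
  have hpart : ∀ m, m ≤ N → ∑ k ∈ Finset.range (m + 1), g.coeff k * (1 : ℝ) ^ k
      = ∑ k ∈ Finset.Ico (N - m) (N + 1), f.coeff k * a ^ k := by
    intro m hm
    rw [← sum_range_reflect_eq_sum_Ico (fun k => f.coeff k * a ^ k) hm]
    refine Finset.sum_congr rfl fun j hj => ?_
    rw [Finset.mem_range] at hj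
    rw [one_pow, mul_one, hgcoeff, if_pos (by omega)]
  rw [slist_congr (fun m hm => hpart m hm)]
  have hrefl := slist_reflect (fun m => ∑ k ∈ Finset.Ico m (N + 1), f.coeff k * a ^ k) N
  rw [show (fun j => ∑ k ∈ Finset.Ico (N - j) (N + 1), f.coeff k * a ^ k)
      = (fun j => (fun m => ∑ k ∈ Finset.Ico m (N + 1), f.coeff k * a ^ k) (N - j)) from rfl, hrefl, sgnChanges_reverse]

end LaguerreClosed

end Summit.ValiantsHypothesis.ValiantsHypothesis.Theorems.LacunarySymmetroidMatrixDescartes.Census
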